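import Summits.QuantumFields.BalabanUV.Beta.GAN24.ContactGaugeStaircaseCauchy

/-!
# `BalabanUV.Beta.GAN24.ContactGaugeStaircaseCauchyPack` — binder row G-an2-4 / (CONV-C), the row owner's CONTACT-TERM ROUTE, step **CT-4b**, part 2 of 2:
# THE GAUGE-STAIRCASE CAUCHY LETTERS PACKAGED AT ONE COMMON RATE FROM `2 ≤ Lc` ALONE (`d = 3`, in-block roots) — part 1
# `ContactGaugeStaircaseCauchy`'s identities and parametric letters with leaf-12's (N1) `RespStepDecay.exists_respStep_decay_and_grad` and the owner's
# CT-4a `RespStepCauchy.exists_respStep_cauchy` plugged in (envelopes are monotone in the rate: `exp_env_mono`).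

NOT IN PRINT; OUR BOOKKEEPING (road-P2 chair `b2b-balaban-gan24-p2`, gen 34; INTENT «CT-4b GAUGE-STAIRCASE-CAUCHY» journal 2026-08-21T19:29Z).
HONEST FRAMING (cell contract, verbatim): «discharging `BetaPertH` makes Bałaban's UV stability UNCONDITIONAL — a real constructive-QFT result; it is
NOT the continuum limit and NOT the Clay problem.»  HONEST DEPENDENCY (verbatim): «continuum YM on T⁴ ⇐ BetaPertH ∧ nine spine estimates (0/9 proved);
BetaPertH ⇐ (D1) ∧ (D4) ∧ CAP+tail; G-an2-4 gates asym, D1 and NE2/3/4.»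
WHAT: §A **`gauge_succ_sub_eq_staircase`** ∕ **`abs_gaugePieceSucc_le`** — the BORN alignment `(m+1, k) ↔ (m, k)` (readout levels `m+1` ∕ `m` of the two towers
are the SAME lattice: no refinement, no extra piece; letters `(8·Lc·(c·θ^(m+k))·(Lc^{5(k+1)})⁻¹)·Lc^s`, CT-4a at base `m+s`) for the `bornSecAt` sectors' Cauchy
letters; §B **`exists_gauge_staircase_cauchy (hLc : 2 ≤ Lc)`** — `∃ κ C c θ, 0 < κ ∧ 0 ≤ C ∧ 0 ≤ c ∧ 0 ≤ θ ∧ θ < 1 ∧ ∀ rr ∈ box (3+1) Lc, ∀ k μ z`, six clauses on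
the taller tower's fine lattice (envelope block `Lc^(k+2)`, `k+1` scales; the `hψ ∕ hG₁` shapes of `StaircasePairing.abs_pairing_le_sum`): (i)∕(ii) tower
`k+1`'s bond gauge staircase (one-formula pieces) and its geometric letters `(8·Lc·C·(Lc^{5(k+2)})⁻¹)·Lc^s′`; (iii)∕(iv) tower `k`'s, transported
(`(Lc^4)⁻¹·λ_k ∘ blk Lc`; zero finest piece), SAME letters; (v)∕(vi) their difference `Σ ΔG s′ ∘ blk (Lc^s′)` with letters `8·Lc·C·(Lc^{5(k+2)})⁻¹` at
`s′ = 0` (the extra finest piece, (δ)) and `(8·Lc·(c·θ^k)·(Lc^{5(k+2)})⁻¹)·Lc^s′` for `1 ≤ s′ ≤ k+1` ((α): `θ^k ×` the undifferenced letters).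
[folklore] packaging; 0 `def`, 0 cited facts, 0 `def … : Prop`, 0 sorry; NO new estimate; discharges NOTHING of hSdev by itself (CT-4c∕4e compose);
0 wall binders; NEVER «G-an2-4 closed»; NOT (CONV-C) as typed, NOT D1, NOT BetaPertH, NOT continuum, NOT Clay.
-/

noncomputable section

open Finset
open scoped BigOperators
open Literature.MathematicalPhysics.QuantumFieldTheory
open Literature.MathematicalPhysics.QuantumFieldTheory.LatticeForm (quo)
open Literature.MathematicalPhysics.QuantumFieldTheory.Balaban1983to89
open Literature.MathematicalPhysics.QuantumFieldTheory.Balaban1983to89.Beta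
open B4ContourShift (supNorm supNorm_nonneg)
open AffineAveraging (Form0 Form1 Site box toSite)
open AveragingContours (blk)
open KKTFluctuationKernel (delta1)
open BalabanCompositeJets (respStep)
open Summit.QuantumFields.BalabanUV.Beta.AxialProjectorBlockMean (bmGaugeAt)
open Summit.QuantumFields.BalabanUV.Beta.GAN24.RespStepBmDecompLegs (legAct)
open Summit.QuantumFields.BalabanUV.Beta.GAN24.RespStepBmDecompPsi (Psi)
open Summit.QuantumFields.BalabanUV.Beta.GAN24.RespStepDecay (exists_respStep_decay_and_grad)
open Summit.QuantumFields.BalabanUV.Beta.GAN24.RespStepCauchy (exists_respStep_cauchy)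
open Summit.QuantumFields.BalabanUV.Beta.GAN24.UndressedResponseUnits (inv_cast_pow_pow)
open Summit.QuantumFields.BalabanUV.Beta.GAN24.StaircaseFaces (blk_one)
open Summit.QuantumFields.BalabanUV.Beta.GAN24.RespStepBmDecomp (blk_blk)
open Summit.QuantumFields.BalabanUV.Beta.GAN24.RespStepBmDecompExact (blk_blk_pow)
open Summit.QuantumFields.BalabanUV.Beta.GAN24.DressedLegEnvelope (blk_pow_blk_pow)
open Summit.QuantumFields.BalabanUV.Beta.GAN24.ContactGaugeStaircaseCauchy (bmGaugeAt_sub exp_env_mono gauge_eq_staircase_uniform gauge_eq_staircase_zero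
  gauge_refine_eq_staircase gauge_coarse_eq_staircase_fine abs_bmGaugeAt_respStep_sub_le abs_gaugePieceDiff_le abs_gaugePieceDiff_zero_le abs_gaugePieceUp_le
  abs_gaugePieceZero_le)

namespace Summit.QuantumFields.BalabanUV.Beta.GAN24.ContactGaugeStaircaseCauchyPack

variable {Lc : ℕ} [NeZero Lc]

/-! ## §A The born alignment `(m+1, k) ↔ (m, k)` (identity generic `d`; letters `d = 3`, parametric in CT-4a) -/

section Born

variable {d : ℕ}

/-- NOT IN PRINT; OUR BOOKKEEPING.  **THE BORN ALIGNMENT `(m+1, k) ↔ (m, k)`** (generic `d`, every root, every `m k μ z u`; the readout levels `m+1`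
of the taller tower and `m` of the shorter one are the SAME lattice — no refinement, no extra piece):
`λ^{(m+1,k)} u − λ^{(m,k)} u = Σ_{s<k+1} D s (blk (Lc^s) u)`, `λ^{(m,k)} u := Psi ρ Lc m k (delta1 μ z) u − bmGaugeAt ρ (respStep (Lc^m) (Lc^(m+k+1)) μ z) Lc u`,
`D s y = −((Lc^{(d+1)s})⁻¹ · bmGaugeAt ρ (legAct (respStep (Lc^(m+1+s)) (Lc^(m+1+k+1))) (delta1 μ z) − legAct (respStep (Lc^(m+s)) (Lc^(m+k+1))) (delta1 μ z)) Lc y)`. -/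
theorem gauge_succ_sub_eq_staircase (ρ : Fin (d + 1) → ℤ) (m k : ℕ) (μ : Fin (d + 1)) (z u : Site (d + 1)) :
    (Psi ρ Lc (m + 1) k (delta1 μ z) u - bmGaugeAt ρ (respStep (d := d) (Lc ^ (m + 1)) (Lc ^ (m + 1 + k + 1)) μ z) Lc u)
      - (Psi ρ Lc m k (delta1 μ z) u - bmGaugeAt ρ (respStep (d := d) (Lc ^ m) (Lc ^ (m + k + 1)) μ z) Lc u)
      = ∑ s ∈ Finset.range (k + 1),
          (fun (s : ℕ) (y : Site (d + 1)) =>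
            -(((Lc : ℝ) ^ ((d + 1) * s))⁻¹ *
              bmGaugeAt ρ (legAct (respStep (d := d) (Lc ^ (m + 1 + s)) (Lc ^ (m + 1 + k + 1))) (delta1 μ z)
                - legAct (respStep (d := d) (Lc ^ (m + s)) (Lc ^ (m + k + 1))) (delta1 μ z)) Lc y)) s (blk (Lc ^ s) u) := by
  rw [gauge_eq_staircase_uniform, gauge_eq_staircase_uniform, ← Finset.sum_sub_distrib]
  refine Finset.sum_congr rfl fun s _ => ?_
  simp only [bmGaugeAt_sub, Pi.sub_apply]
  ring

variable {rr : Fin (3 + 1) → ℕ}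

/-- NOT IN PRINT; OUR BOOKKEEPING.  **THE BORN ALIGNMENT's LETTERS** (`d = 3`, in-block root; PARAMETRIC in CT-4a's `c, θ, κ₁`): for every `s ≤ k` and `u`,
`|D s (blk (Lc^s) u)| ≤ (8·Lc·(c·θ^(m+k))·(Lc^{5(k+1)})⁻¹·Lc^s)·e^{−κ₁‖quo (Lc^(k+1)) u − z‖∞}` (`D` of `gauge_succ_sub_eq_staircase`; CT-4a at base `m+s`). -/
theorem abs_gaugePieceSucc_le {c θ κ₁ : ℝ}
    (hCau : ∀ (s k : ℕ) (μ : Fin (3 + 1)) (z : Site (3 + 1)) (l : Fin (3 + 1)) (w : Site (3 + 1)),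
      |respStep (d := 3) (Lc ^ (s + 1)) (Lc ^ (s + k + 2)) μ z l w - respStep (d := 3) (Lc ^ s) (Lc ^ (s + k + 1)) μ z l w|
        ≤ c * θ ^ (s + k) * ((((Lc ^ (k + 1) : ℕ) : ℝ)) ^ (3 + 2))⁻¹ * Real.exp (-(κ₁ * supNorm (quo (Lc ^ (k + 1)) w - z))))
    (hrr : rr ∈ box (3 + 1) Lc) (m k : ℕ) (μ : Fin (3 + 1)) (z : Site (3 + 1)) {s : ℕ} (hs : s ≤ k) (u : Site (3 + 1)) :
    |(fun (s : ℕ) (y : Site (3 + 1)) =>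
        -(((Lc : ℝ) ^ ((3 + 1) * s))⁻¹ *
          bmGaugeAt (toSite rr) (legAct (respStep (d := 3) (Lc ^ (m + 1 + s)) (Lc ^ (m + 1 + k + 1))) (delta1 μ z)
            - legAct (respStep (d := 3) (Lc ^ (m + s)) (Lc ^ (m + k + 1))) (delta1 μ z)) Lc y)) s (blk (Lc ^ s) u)|
      ≤ 8 * (Lc : ℝ) * (c * θ ^ (m + k)) * ((Lc : ℝ) ^ (5 * (k + 1)))⁻¹ * (Lc : ℝ) ^ s *
          Real.exp (-(κ₁ * supNorm (quo (Lc ^ (k + 1)) u - z))) := by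
  have hL0 : (0 : ℝ) < Lc := by exact_mod_cast Nat.pos_of_ne_zero (NeZero.ne Lc)
  simp only [abs_neg]
  have hg := abs_bmGaugeAt_respStep_sub_le (Lc := Lc) hCau hrr (m + s) (k - s) μ z (blk (Lc ^ s) u)
  rw [show m + s + (k - s) + 2 = m + 1 + k + 1 by omega, show m + s + (k - s) + 1 = m + k + 1 by omega,
    show m + s + 1 = m + 1 + s by ring, show m + s + (k - s) = m + k by omega] at hg
  have hlab : blk (Lc ^ (k - s)) (blk Lc (blk (Lc ^ s) u)) = quo (Lc ^ (k + 1)) u := by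
    rw [blk_blk_pow, blk_pow_blk_pow, show s + 1 + (k - s) = k + 1 by omega]
    rfl
  rw [hlab] at hg
  rw [abs_mul, abs_inv, abs_pow, abs_of_pos hL0]
  calc ((Lc : ℝ) ^ ((3 + 1) * s))⁻¹ * |bmGaugeAt (toSite rr)
          (legAct (respStep (d := 3) (Lc ^ (m + 1 + s)) (Lc ^ (m + 1 + k + 1))) (delta1 μ z)
            - legAct (respStep (d := 3) (Lc ^ (m + s)) (Lc ^ (m + k + 1))) (delta1 μ z)) Lc (blk (Lc ^ s) u)|
      ≤ ((Lc : ℝ) ^ ((3 + 1) * s))⁻¹ *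
          (8 * (Lc : ℝ) * (c * θ ^ (m + k)) * ((Lc : ℝ) ^ (5 * (k - s + 1)))⁻¹ *
            Real.exp (-(κ₁ * supNorm (quo (Lc ^ (k + 1)) u - z)))) :=
        mul_le_mul_of_nonneg_left hg (by positivity)
    _ = 8 * (Lc : ℝ) * (c * θ ^ (m + k)) * ((Lc : ℝ) ^ (5 * (k + 1)))⁻¹ * (Lc : ℝ) ^ s *
          Real.exp (-(κ₁ * supNorm (quo (Lc ^ (k + 1)) u - z))) := by
        have e : (Lc : ℝ) ^ (5 * (k + 1))
            = (Lc : ℝ) ^ ((3 + 1) * s) * (Lc : ℝ) ^ (5 * (k - s + 1)) * (Lc : ℝ) ^ s := by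
          rw [← pow_add, ← pow_add]
          congr 1
          omega
        rw [e]
        field_simp

end Born

/-! ## §B The packaged form at one common rate -/

/-- NOT IN PRINT; OUR BOOKKEEPING.  **CT-4b PACKAGED** (`d = 3`, every `Lc ≥ 2`, NO hypothesis; in-block roots): ONE rate `κ > 0` (the minimum of leaf-12's (N1)
rate and the owner's CT-4a rate) and constants `C, c ≥ 0`, `0 ≤ θ < 1` such that for EVERY in-block root `rr`, every `k` and every source bond `(μ, z)`,
on the taller tower's fine lattice (`u′`; envelope block `Lc^(k+2)`; all in the `hψ ∕ hG₁` shapes of `StaircasePairing.abs_pairing_le_sum` with `k+1` scales):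
(i) tower `k+1`'s bond gauge function IS the clean-index staircase `Σ_{s′<k+2} G_{k+1} s′ ∘ blk (Lc^s′)` with geometric letters `(8·Lc·C·(Lc^{5(k+2)})⁻¹)·Lc^s′`;
(ii) tower `k`'s, transported (`(Lc^4)⁻¹·λ_k ∘ blk Lc`), IS the staircase `Σ Gup s′ ∘ blk (Lc^s′)` (zero finest piece) with the SAME letters;
(iii) their difference IS the staircase `Σ ΔG s′ ∘ blk (Lc^s′)` with letters `8·Lc·C·(Lc^{5(k+2)})⁻¹` at `s′ = 0` (the extra finest piece, (δ)) and
`(8·Lc·(c·θ^k)·(Lc^{5(k+2)})⁻¹)·Lc^s′` for `1 ≤ s′ ≤ k+1` ((α): `θ^k ×` the undifferenced letters, `θ` the CT-4a rate). -/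
theorem exists_gauge_staircase_cauchy (hLc : 2 ≤ Lc) :
    ∃ κ C c θ : ℝ, 0 < κ ∧ 0 ≤ C ∧ 0 ≤ c ∧ 0 ≤ θ ∧ θ < 1 ∧
      ∀ (rr : Fin (3 + 1) → ℕ), rr ∈ box (3 + 1) Lc → ∀ (k : ℕ) (μ : Fin (3 + 1)) (z : Site (3 + 1)),
        (∀ u' : Site (3 + 1),
          Psi (toSite rr) Lc 0 (k + 1) (delta1 μ z) u' - bmGaugeAt (toSite rr) (respStep (d := 3) 1 (Lc ^ (k + 2)) μ z) Lc u'
            = ∑ s' ∈ Finset.range (k + 2),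
                (fun (s' : ℕ) (y : Site (3 + 1)) =>
                  -(((Lc : ℝ) ^ ((3 + 1) * s'))⁻¹ *
                    bmGaugeAt (toSite rr) (legAct (respStep (d := 3) (Lc ^ s') (Lc ^ (k + 2))) (delta1 μ z)) Lc y)) s' (blk (Lc ^ s') u')) ∧
        (∀ s', s' ≤ k + 1 → ∀ u' : Site (3 + 1),
          |(fun (s' : ℕ) (y : Site (3 + 1)) =>
              -(((Lc : ℝ) ^ ((3 + 1) * s'))⁻¹ *
                bmGaugeAt (toSite rr) (legAct (respStep (d := 3) (Lc ^ s') (Lc ^ (k + 2))) (delta1 μ z)) Lc y)) s' (blk (Lc ^ s') u')|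
            ≤ (8 * (Lc : ℝ) * C * ((Lc : ℝ) ^ (5 * (k + 2)))⁻¹ * (Lc : ℝ) ^ s') *
                Real.exp (-(κ * supNorm (quo (Lc ^ (k + 2)) u' - z)))) ∧
        (∀ u' : Site (3 + 1),
          ((Lc : ℝ) ^ (3 + 1))⁻¹ *
              (Psi (toSite rr) Lc 0 k (delta1 μ z) (blk Lc u')
                - bmGaugeAt (toSite rr) (respStep (d := 3) 1 (Lc ^ (k + 1)) μ z) Lc (blk Lc u'))
            = ∑ s' ∈ Finset.range (k + 2),
                (fun (s' : ℕ) (y : Site (3 + 1)) =>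
                  if s' = 0 then (0 : ℝ)
                  else -(((Lc : ℝ) ^ ((3 + 1) * s'))⁻¹ *
                    bmGaugeAt (toSite rr) (legAct (respStep (d := 3) (Lc ^ (s' - 1)) (Lc ^ (k + 1))) (delta1 μ z)) Lc y))
                  s' (blk (Lc ^ s') u')) ∧
        (∀ s', s' ≤ k + 1 → ∀ u' : Site (3 + 1),
          |(fun (s' : ℕ) (y : Site (3 + 1)) =>
              if s' = 0 then (0 : ℝ)
              else -(((Lc : ℝ) ^ ((3 + 1) * s'))⁻¹ *
                bmGaugeAt (toSite rr) (legAct (respStep (d := 3) (Lc ^ (s' - 1)) (Lc ^ (k + 1))) (delta1 μ z)) Lc y))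
              s' (blk (Lc ^ s') u')|
            ≤ (8 * (Lc : ℝ) * C * ((Lc : ℝ) ^ (5 * (k + 2)))⁻¹ * (Lc : ℝ) ^ s') *
                Real.exp (-(κ * supNorm (quo (Lc ^ (k + 2)) u' - z)))) ∧
        (∀ u' : Site (3 + 1),
          (Psi (toSite rr) Lc 0 (k + 1) (delta1 μ z) u' - bmGaugeAt (toSite rr) (respStep (d := 3) 1 (Lc ^ (k + 2)) μ z) Lc u')
            - ((Lc : ℝ) ^ (3 + 1))⁻¹ *
              (Psi (toSite rr) Lc 0 k (delta1 μ z) (blk Lc u')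
                - bmGaugeAt (toSite rr) (respStep (d := 3) 1 (Lc ^ (k + 1)) μ z) Lc (blk Lc u'))
            = ∑ s' ∈ Finset.range (k + 2),
                (fun (s' : ℕ) (y : Site (3 + 1)) =>
                  if s' = 0 then -bmGaugeAt (toSite rr) (legAct (respStep (d := 3) 1 (Lc ^ (k + 2))) (delta1 μ z)) Lc y
                  else -(((Lc : ℝ) ^ ((3 + 1) * s'))⁻¹ *
                    bmGaugeAt (toSite rr) (legAct (respStep (d := 3) (Lc ^ s') (Lc ^ (k + 2))) (delta1 μ z)
                      - legAct (respStep (d := 3) (Lc ^ (s' - 1)) (Lc ^ (k + 1))) (delta1 μ z)) Lc y)) s' (blk (Lc ^ s') u')) ∧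
        (∀ s', s' ≤ k + 1 → ∀ u' : Site (3 + 1),
          |(fun (s' : ℕ) (y : Site (3 + 1)) =>
              if s' = 0 then -bmGaugeAt (toSite rr) (legAct (respStep (d := 3) 1 (Lc ^ (k + 2))) (delta1 μ z)) Lc y
              else -(((Lc : ℝ) ^ ((3 + 1) * s'))⁻¹ *
                bmGaugeAt (toSite rr) (legAct (respStep (d := 3) (Lc ^ s') (Lc ^ (k + 2))) (delta1 μ z)
                  - legAct (respStep (d := 3) (Lc ^ (s' - 1)) (Lc ^ (k + 1))) (delta1 μ z)) Lc y)) s' (blk (Lc ^ s') u')|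
            ≤ (if s' = 0 then 8 * (Lc : ℝ) * C * ((Lc : ℝ) ^ (5 * (k + 2)))⁻¹
                else 8 * (Lc : ℝ) * (c * θ ^ k) * ((Lc : ℝ) ^ (5 * (k + 2)))⁻¹ * (Lc : ℝ) ^ s') *
              Real.exp (-(κ * supNorm (quo (Lc ^ (k + 2)) u' - z)))) := by
  obtain ⟨κ₀, C, -, hκ₀, hC, -, hN1', -⟩ := exists_respStep_decay_and_grad (Lc := Lc)
  have hN1 : ∀ (m k : ℕ) (μ : Fin (3 + 1)) (z : Site (3 + 1)) (l'' : Fin (3 + 1)) (w' : Site (3 + 1)),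
      |respStep (d := 3) (Lc ^ m) (Lc ^ (m + k + 1)) μ z l'' w'| ≤
        C * ((Lc : ℝ) ^ (5 * (k + 1)))⁻¹ * Real.exp (-(κ₀ * supNorm (quo (Lc ^ (k + 1)) w' - z))) := by
    intro m k μ z l'' w'
    have h := hN1' m k μ z l'' w'
    rwa [inv_cast_pow_pow] at h
  obtain ⟨c, θ, κ₁, hc, hθ0, hθ1, hκ₁, hCau⟩ := exists_respStep_cauchy (Lc := Lc) hLc
  have hL0 : (0 : ℝ) ≤ Lc := by positivity
  refine ⟨min κ₀ κ₁, C, c, θ, lt_min hκ₀ hκ₁, hC, hc, hθ0, hθ1, fun rr hrr k μ z => ⟨?_, ?_, ?_, ?_, ?_, ?_⟩⟩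
  · intro u'
    have h := gauge_eq_staircase_zero (Lc := Lc) (toSite rr) (k + 1) μ z u'
    rw [show k + 1 + 1 = k + 2 from rfl] at h
    exact h
  · intro s' hs u'
    refine (abs_gaugePieceZero_le hN1 hrr (k + 1) μ z hs u').trans ?_
    rw [show k + 1 + 1 = k + 2 from rfl]
    exact mul_le_mul_of_nonneg_left (exp_env_mono (min_le_left _ _) (supNorm_nonneg _)) (by positivity)
  · intro u'
    exact gauge_coarse_eq_staircase_fine (Lc := Lc) (toSite rr) k μ z u'
  · intro s' hs u'
    refine (abs_gaugePieceUp_le hC hN1 hrr k μ z hs u').trans ?_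
    exact mul_le_mul_of_nonneg_left (exp_env_mono (min_le_left _ _) (supNorm_nonneg _)) (by positivity)
  · intro u'
    exact gauge_refine_eq_staircase (Lc := Lc) (toSite rr) k μ z u'
  · intro s' hs u'
    rcases Nat.eq_zero_or_pos s' with h0 | hpos
    · subst h0
      simp only [if_true]
      have h := abs_gaugePieceDiff_zero_le hN1 hrr k μ z u'
      simp only [if_true, pow_zero, blk_one] at h ⊢
      refine h.trans ?_
      exact mul_le_mul_of_nonneg_left (exp_env_mono (min_le_left _ _) (supNorm_nonneg _)) (by positivity)
    · have hne : s' ≠ 0 := by omega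
      rw [if_neg hne]
      refine (abs_gaugePieceDiff_le hCau hrr k μ z hpos hs u').trans ?_
      exact mul_le_mul_of_nonneg_left (exp_env_mono (min_le_right _ _) (supNorm_nonneg _)) (by positivity)


end Summit.QuantumFields.BalabanUV.Beta.GAN24.ContactGaugeStaircaseCauchyPack

end
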